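import Summits.QuantumFields.YangMills.Theorems.UnitScaleTiltProp7TransportedInterpolantOfRegPr
import Summits.QuantumFields.YangMills.Theorems.UnitScaleTiltProp7CovariantBlockBumpsRows
import HarnessLib

/-!
# Route `UnitScaleTilt`, crux K1 «MinimiserStabilityRegPr» (stmt-QuantumFields-19200), EX face — K-storey (px12 g16 LOCATE-K137), pen (K1b-a) (px13 g15; LOCATE #43 §6 (F3)) —
# **THE COVARIANT GRADIENT ROW (s2) OF THE TRANSPORTED INTERPOLANT**: per fine bond, the dressed separable bump costs `|m|·(2M_ψ·s + Lip_ψ + M_ψ)·‖c(B^k x)‖`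

Cell `ym3-torus` (HUMAN RULING D-0037; rung R3 = SU(2) YM₃ on T³ — NOT d = 4, NOT infinite volume, NOT a mass gap, NOT Clay).  Width seat `ym3-torus-px13` (gen 15).  THEOREMS ONLY
(0 `def`, 0 `sorry`); `--supports stmt-QuantumFields-19200 --as helper`; count-neutral; nothing of Bałaban's asserted.

THE MATHEMATICS (px10 g9's (BUMP) pattern ✓`Prop7CovariantBlockBumpsRows.norm_transport_dressed_bond_le`, with the SEPARABLE profile `ψ_μ = p(off_μ)·Π_{κ≠μ}τ(off_κ)` of (K1b-a) in place of
the parabola^d).  §1 (generic `P`, weights `p τ : ℕ → ℝ` with `p(0) = 0`, `τ(0) = 0`, sup bounds `M_p, M_τ` and Lipschitz bounds `L_p, L_τ`): ACROSS ONE FINE BOND `⟨x, ν⟩` EITHER both ends lie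
in one block and `|ψ_μ(x+e_ν) − ψ_μ(x)| ≤ L_pM_τ^{d−1} + M_pL_τM_τ^{d−2}`, OR `ψ_μ(x+e_ν) = 0` (a face: `off_ν(x+e_ν) = 0` kills `p` if `ν = μ`, `τ` otherwise); always `|ψ_μ(x)| ≤ M_pM_τ^{d−1}`.
§2 (member, `PlaqSmall (regThreshold) U₀`, `n < K`): the dressed field `g(x) = ψ_μ(x) • Ad_{σ_x⁻¹}(m • Ad_{Φ(B^k x)} c(B^k x))` (`σ_x = axialT U₀♭ corner x`, `Φ = axialT U₀♭ corner (embIter)`,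
✓`axialT_bgUnits_eq`) obeys `‖U₀(b)g(x+e_ν)U₀(b)⋆ − g(x)‖ ≤ |m|(2M_ψ·s + Lip_ψ + M_ψ)‖c(B^k x)‖`, `s = 2·3(ℓ−1)·a₀` (✓`norm_axialGauge_bond_sub_one_le_T3`, ✓`norm_transport_dressed_sub_le`).
§3: summed by ✓`normSq_DL2_le_of_blockDominated` over the `d` components: the (s2) letter `hED` of px12 ✓`Prop7KinvBoundOfInterpolant` for ANY `E` whose field has this shape.
HONEST SCOPE.  (s2) for the generic separable transported bump; the numeric skew ⊗ parabola² edition, (K1b), K137, EX and the crux are NOT proved here.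

References: T. Bałaban, CMP **99** (1985) 75–102 [Balaban1985RegularSpaces] (Lemma 1 (1.25) p.79); CMP **99** (1985) 389–434 [Balaban1985BackgroundPropagators] ((3.3) p.391, (3.11) p.392);
CMP **95** (1984) 17–40 [Balaban1984PropagatorsI] ((1.6) p.18, (1.18) p.20).
-/

set_option autoImplicit false

noncomputable section

open scoped BigOperators Matrix.Norms.L2Operator Matrix

namespace Summit.QuantumFields.YangMills.Theorems.Prop7TransportedInterpolantGradient

open Literature.MathematicalPhysics.QuantumFieldTheory.Balaban1983to89
open Literature.MathematicalPhysics.QuantumFieldTheory.Balaban1983to89.T3ContinuumYM3Torus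
open Finset T4Continuum BlockAveraging LatticeFieldCalculus B1RG242Torus
open B5Eq118OneStroke (iterBlockOf)
open B7Prop1Explicit (U1)
open B7Eq78Linearization (conjR conjR_apply conjR_smul conjR_smul_real)
open B8Ineq132 (conjR_conjR one_conjR norm_conjR)
open B9Eq311L2Pairing (WL2)
open B10Eq27TorusAxialLog (holT holT_map axialT unitsField toUField suIncl gaugeActT gaugeActT_apply)
open B11Eq103H1Complex (BondL2K)
open B15DeterminingSets (embIter)
open T3LevelShift (bondShift)
open T3PrintedRegularOrbits (sites_eq)
open T3PrintedRegularMinimiser (RegPr)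
open T3RegularMinimiser (regThreshold regThreshold_pos)
open T3SectALandauChart (eta eta_pos bgUnits formComp)
open Summit.QuantumFields.YangMills.Theorems.Prop7SectET3Transport (periodsT3)
open Summit.QuantumFields.YangMills.Theorems.Prop7SectET3HilbertLetters (W₂ frobEquiv toL2 toL2B toL2S DL2)
open Summit.QuantumFields.YangMills.Theorems.Prop7SectET3CurvedPropagators (Qk)
open Summit.QuantumFields.YangMills.Theorems.Prop7SymAvgTwSym (holT_mem_U1 unitsField_toUField_mem_U1')
open Summit.QuantumFields.YangMills.Theorems.Prop7FlatHolonomy (sitesPerDir_zero_eq_mul_pow)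
open Summit.QuantumFields.YangMills.Theorems.Prop7CovariantBlockBumpsProfile (norm_transport_dressed_sub_le shift_offsets_of_lt shift_offset_eq_zero_of_eq)
open Summit.QuantumFields.YangMills.Theorems.Prop7CovariantBlockBumpsRows (normSq_DL2_le_of_blockDominated)
open Summit.QuantumFields.YangMills.Theorems.Prop7NestedMeanTowerCloseness (norm_axialGauge_bond_sub_one_le_T3)
open Summit.QuantumFields.YangMills.Theorems.Prop7RieszTauFrobNorm (norm_sq_frobEquiv_symm norm_le_norm_frobEquiv_symm)
open Summit.QuantumFields.YangMills.Theorems.Prop7LaplaceAFlatLetters (norm_sq_toL2B)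
open Summit.QuantumFields.YangMills.Theorems.Prop7TransportedBumpNorms (axialFrame_mem_U1)

/-! ## §1 The separable profile across one fine bond (generic `P`, level `k`) -/

section Profile

variable {P : Params} {k : ℕ}

/-- `|Π_{κ ∈ s} τ(off_κ x)| ≤ M_τ^{|s|}` when `|τ| ≤ M_τ` on `[0, ℓ)`. [folklore] -/
theorem abs_prod_tau_le (τ : ℕ → ℝ) {Mτ : ℝ} (hMτ : ∀ m, m < P.L ^ k → |τ m| ≤ Mτ) (s : Finset (Fin P.d)) (x : Site P 0) :
    |∏ κ ∈ s, τ ((x κ).val % P.L ^ k)| ≤ Mτ ^ s.card := by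
  rw [Finset.abs_prod, ← Finset.prod_const]
  exact Finset.prod_le_prod (fun _ _ => abs_nonneg _) fun κ _ => hMτ _ (Nat.mod_lt _ (pow_pos P.L_pos k))

/-- **THE SUP OF THE SEPARABLE PROFILE**: `|ψ_μ(x)| ≤ M_p·M_τ^{d−1}`. [folklore] -/
theorem abs_psi_le (p τ : ℕ → ℝ) {Mp Mτ : ℝ} (hMp : ∀ s, s < P.L ^ k → |p s| ≤ Mp) (hMτ : ∀ m, m < P.L ^ k → |τ m| ≤ Mτ)
    (μ : Fin P.d) (x : Site P 0) :
    |p ((x μ).val % P.L ^ k) * ∏ κ ∈ univ.erase μ, τ ((x κ).val % P.L ^ k)| ≤ Mp * Mτ ^ (P.d - 1) := by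
  rw [abs_mul]
  have hcard : (univ.erase μ).card = P.d - 1 := by rw [Finset.card_erase_of_mem (Finset.mem_univ μ), Finset.card_univ, Fintype.card_fin]
  have h1 := abs_prod_tau_le τ hMτ (univ.erase μ) x
  rw [hcard] at h1
  exact mul_le_mul (hMp _ (Nat.mod_lt _ (pow_pos P.L_pos k))) h1 (abs_nonneg _) ((abs_nonneg _).trans (hMp 0 (pow_pos P.L_pos k)))

/-- ★ **THE SEPARABLE PROFILE ACROSS ONE BOND**: for every fine bond `⟨x, ν⟩` and component `μ`, EITHER both ends lie in one `k`-block and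
`|ψ_μ(x+e_ν) − ψ_μ(x)| ≤ L_p·M_τ^{d−1} + M_p·L_τ·M_τ^{d−2}`, OR `ψ_μ(x+e_ν) = 0` (the bond crosses a block face: `off_ν(x+e_ν) = 0`, and `p(0) = 0`, `τ(0) = 0`).
[cite: Balaban1984PropagatorsI, (1.6) p.18] -/
theorem psi_bond (hk : k ≤ P.m + P.K) (p τ : ℕ → ℝ) (hp0 : p 0 = 0) (hτ0 : τ 0 = 0) (hτl : τ (P.L ^ k - 1) = 0) {Mp Lp Pl Mτ Lτ : ℝ}
    (hMp : ∀ s, s < P.L ^ k → |p s| ≤ Mp) (hLp : ∀ s, s + 1 < P.L ^ k → |p (s + 1) - p s| ≤ Lp) (hpl : |p (P.L ^ k - 1)| ≤ Pl)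
    (hMτ : ∀ m, m < P.L ^ k → |τ m| ≤ Mτ) (hLτ : ∀ m, m + 1 < P.L ^ k → |τ (m + 1) - τ m| ≤ Lτ)
    (hMp0 : 0 ≤ Mp) (hLp0 : 0 ≤ Lp) (hPl0 : 0 ≤ Pl) (hMτ0 : 0 ≤ Mτ) (hLτ0 : 0 ≤ Lτ) (μ : Fin P.d) (x : Site P 0) (ν : Fin P.d) :
    (iterBlockOf k (x.shift ν) = iterBlockOf k x ∧
      |p (((x.shift ν) μ).val % P.L ^ k) * ∏ κ ∈ univ.erase μ, τ (((x.shift ν) κ).val % P.L ^ k)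
          - p ((x μ).val % P.L ^ k) * ∏ κ ∈ univ.erase μ, τ ((x κ).val % P.L ^ k)|
        ≤ Lp * Mτ ^ (P.d - 1) + Mp * Lτ * Mτ ^ (P.d - 2)) ∨
    (p (((x.shift ν) μ).val % P.L ^ k) * ∏ κ ∈ univ.erase μ, τ (((x.shift ν) κ).val % P.L ^ k) = 0 ∧
      |p ((x μ).val % P.L ^ k) * ∏ κ ∈ univ.erase μ, τ ((x κ).val % P.L ^ k)| ≤ Pl * Mτ ^ (P.d - 1)) := by
  classical
  have hℓ : 0 < P.L ^ k := pow_pos P.L_pos k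
  have hlt : (x ν).val % P.L ^ k < P.L ^ k := Nat.mod_lt _ hℓ
  have hcardμ : (univ.erase μ).card = P.d - 1 := by rw [Finset.card_erase_of_mem (Finset.mem_univ μ), Finset.card_univ, Fintype.card_fin]
  by_cases hcase : (x ν).val % P.L ^ k + 1 < P.L ^ k
  · left
    obtain ⟨hblk, hoff, hothers⟩ := shift_offsets_of_lt hk x ν hcase
    refine ⟨hblk, ?_⟩
    by_cases hνμ : ν = μ
    · subst hνμ
      have hprod : ∏ κ ∈ univ.erase ν, τ (((x.shift ν) κ).val % P.L ^ k) = ∏ κ ∈ univ.erase ν, τ ((x κ).val % P.L ^ k) :=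
        Finset.prod_congr rfl fun κ hκ => by rw [hothers κ (Finset.ne_of_mem_erase hκ)]
      rw [hprod, hoff, ← sub_mul, abs_mul]
      have h1 := abs_prod_tau_le τ hMτ (univ.erase ν) x
      rw [hcardμ] at h1
      calc |p ((x ν).val % P.L ^ k + 1) - p ((x ν).val % P.L ^ k)| * |∏ κ ∈ univ.erase ν, τ ((x κ).val % P.L ^ k)|
          ≤ Lp * Mτ ^ (P.d - 1) := mul_le_mul (hLp _ hcase) h1 (abs_nonneg _) hLp0
        _ ≤ Lp * Mτ ^ (P.d - 1) + Mp * Lτ * Mτ ^ (P.d - 2) := le_add_of_nonneg_right (by positivity)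
    · have hνmem : ν ∈ univ.erase μ := Finset.mem_erase.mpr ⟨hνμ, Finset.mem_univ ν⟩
      have hpeq : p (((x.shift ν) μ).val % P.L ^ k) = p ((x μ).val % P.L ^ k) := by rw [hothers μ (fun h => hνμ h.symm)]
      have hrest : ∏ κ ∈ (univ.erase μ).erase ν, τ (((x.shift ν) κ).val % P.L ^ k) = ∏ κ ∈ (univ.erase μ).erase ν, τ ((x κ).val % P.L ^ k) :=
        Finset.prod_congr rfl fun κ hκ => by rw [hothers κ (Finset.ne_of_mem_erase hκ)]
      rw [hpeq, ← Finset.mul_prod_erase (univ.erase μ) _ hνmem, ← Finset.mul_prod_erase (univ.erase μ) (fun κ => τ ((x κ).val % P.L ^ k)) hνmem,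
        hrest, hoff, ← mul_sub, ← sub_mul, abs_mul, abs_mul]
      have hcard2 : ((univ.erase μ).erase ν).card = P.d - 2 := by
        rw [Finset.card_erase_of_mem hνmem, hcardμ]; omega
      have h1 := abs_prod_tau_le τ hMτ ((univ.erase μ).erase ν) x
      rw [hcard2] at h1
      calc |p ((x μ).val % P.L ^ k)| * (|τ ((x ν).val % P.L ^ k + 1) - τ ((x ν).val % P.L ^ k)| * |∏ κ ∈ (univ.erase μ).erase ν, τ ((x κ).val % P.L ^ k)|)
          ≤ Mp * (Lτ * Mτ ^ (P.d - 2)) :=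
            mul_le_mul (hMp _ (Nat.mod_lt _ hℓ)) (mul_le_mul (hLτ _ hcase) h1 (abs_nonneg _) hLτ0) (by positivity) hMp0
        _ = Mp * Lτ * Mτ ^ (P.d - 2) := by ring
        _ ≤ Lp * Mτ ^ (P.d - 1) + Mp * Lτ * Mτ ^ (P.d - 2) := le_add_of_nonneg_left (by positivity)
  · right
    have heq : (x ν).val % P.L ^ k + 1 = P.L ^ k := by omega
    have hxl : (x ν).val % P.L ^ k = P.L ^ k - 1 := by omega
    have h0 := shift_offset_eq_zero_of_eq hk x ν heq
    by_cases hνμ : ν = μ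
    · subst hνμ
      refine ⟨by rw [h0, hp0, zero_mul], ?_⟩
      rw [hxl, abs_mul]
      have h1 := abs_prod_tau_le τ hMτ (univ.erase ν) x
      rw [hcardμ] at h1
      exact mul_le_mul hpl h1 (abs_nonneg _) hPl0
    · refine ⟨?_, ?_⟩
      · apply mul_eq_zero_of_right
        exact Finset.prod_eq_zero (Finset.mem_erase.mpr ⟨hνμ, Finset.mem_univ ν⟩) (by rw [h0, hτ0])
      · have hz : p ((x μ).val % P.L ^ k) * ∏ κ ∈ univ.erase μ, τ ((x κ).val % P.L ^ k) = 0 := by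
          apply mul_eq_zero_of_right
          exact Finset.prod_eq_zero (Finset.mem_erase.mpr ⟨hνμ, Finset.mem_univ ν⟩) (by rw [hxl, hτl])
        rw [hz, abs_zero]; positivity

end Profile

/-! ## §2 The member: the dressed separable bump across one fine bond -/

section Bond

variable (F : T3Family) (n K : ℕ) (h : n ≤ K) (c₀ cB : ℝ) [Fact (0 < c₀)] [Fact (0 < cB)]

/-- The `SU(2)` axial transport read in `(M₂)ˣ` IS the axial transport of `U₀♭` (transports are natural in the group, ✓`holT_map`). [cite: Balaban1985Averaging, (9) p.19, (19) p.21] -/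
theorem axialT_bgUnits_eq (U₀ : GaugeField (F.P K) 0 (Matrix.specialUnitaryGroup (Fin 2) ℂ)) (q x : Site (F.P K) 0) :
    axialT (bgUnits F K U₀) q x = Unitary.toUnits (suIncl (axialT U₀ q x)) := by
  show holT (fun b => (Unitary.toUnits.comp (suIncl (N := 2))) (U₀ b)) q _ = (Unitary.toUnits.comp (suIncl (N := 2))) (holT U₀ q _)
  exact holT_map _ U₀ q _

/-- **THE DRESSED BUMP IN px10 g9's LETTERS**: `ψ • Ad_{A⁻¹}(m • Ad_E c) = (ψ·m) • Ad_{(E⁻¹A)⁻¹} c`. [cite: Balaban1985Averaging, (18)–(19) p.21] -/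
theorem dressed_eq (ψ m : ℝ) (A E : (Matrix (Fin 2) (Fin 2) ℂ)ˣ) (c : Matrix (Fin 2) (Fin 2) ℂ) :
    ψ • conjR A⁻¹ (m • conjR E c) = (((ψ * m : ℝ)) : ℂ) • conjR (E⁻¹ * A)⁻¹ c := by
  rw [conjR_smul_real, smul_smul, conjR_conjR, mul_inv_rev, inv_inv, Complex.coe_smul]

/-- ★★ **THE PER-BOND ROW OF THE DRESSED SEPARABLE BUMP** (`PlaqSmall (regThreshold F n K ε₀) U₀`, `n < K`; block datum `c`, amplitude `m`, component `μ`): for EVERY fine bond `⟨x, ν⟩`,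
`‖U₀(b)·g(x+e_ν)·U₀(b)⋆ − g(x)‖ ≤ |m|·(2·(M_pM_τ^{d−1})·s + (L_pM_τ^{d−1} + M_pL_τM_τ^{d−2}) + M_pM_τ^{d−1})·‖c(B^k x)‖`, `s = 2·3(ℓ−1)·a₀`, where
`g(x) = ψ_μ(x) • Ad_{(σ_{B^kx}(x)♭)⁻¹}(m • Ad_{Φ(B^kx)} c(B^kx))` — inside a block ✓`norm_transport_dressed_sub_le` with the axial link `≤ s` from `1` (✓`norm_axialGauge_bond_sub_one_le_T3`),
across a face the shifted end vanishes (§1) and the unshifted end costs `|m|M_ψ‖c‖` (`Ad_{U1}` isometry). [cite: Balaban1985RegularSpaces, Lemma 1 (1.25) p.79; Balaban1985BackgroundPropagators, (3.3) p.391] -/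
theorem norm_transport_bump_bond_le (hnK : n < K) {ε₀ : ℝ} (hε₀ : 0 < ε₀) (U₀ : GaugeField (F.P K) 0 (Matrix.specialUnitaryGroup (Fin 2) ℂ))
    (hU : PlaqSmall (regThreshold F n K ε₀) U₀) (p τ : ℕ → ℝ) (hp0 : p 0 = 0) (hτ0 : τ 0 = 0) (hτl : τ ((F.P K).L ^ (K - n) - 1) = 0) {Mp Lp Pl Mτ Lτ : ℝ}
    (hMp : ∀ s, s < (F.P K).L ^ (K - n) → |p s| ≤ Mp) (hLp : ∀ s, s + 1 < (F.P K).L ^ (K - n) → |p (s + 1) - p s| ≤ Lp) (hpl : |p ((F.P K).L ^ (K - n) - 1)| ≤ Pl)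
    (hMτ : ∀ m, m < (F.P K).L ^ (K - n) → |τ m| ≤ Mτ) (hLτ : ∀ m, m + 1 < (F.P K).L ^ (K - n) → |τ (m + 1) - τ m| ≤ Lτ)
    (hMp0 : 0 ≤ Mp) (hLp0 : 0 ≤ Lp) (hPl0 : 0 ≤ Pl) (hMτ0 : 0 ≤ Mτ) (hLτ0 : 0 ≤ Lτ) (m : ℝ)
    (c : Site (F.P K) (K - n) → Matrix (Fin 2) (Fin 2) ℂ) (μ : Fin (F.P K).d) (x : Site (F.P K) 0) (ν : Fin (F.P K).d) :
    ‖conjR (bgUnits F K U₀ ⟨x, ν⟩)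
        ((p ((((x.shift ν) μ).val % (F.P K).L ^ (K - n))) * ∏ κ ∈ univ.erase μ, τ ((((x.shift ν) κ).val % (F.P K).L ^ (K - n))))
          • conjR (Unitary.toUnits (suIncl ((axialT U₀ (Site.fibreSite 0 (K - n) (iterBlockOf (K - n) (x.shift ν)) fun _ => (⟨0, pow_pos (F.P K).L_pos (K - n)⟩ : Fin ((F.P K).L ^ (K - n))))) (x.shift ν))))⁻¹
            (m • conjR (axialT (unitsField (toUField U₀)) (Site.fibreSite 0 (K - n) (iterBlockOf (K - n) (x.shift ν)) fun _ => (⟨0, pow_pos (F.P K).L_pos (K - n)⟩ : Fin ((F.P K).L ^ (K - n)))) (embIter (K - n) (iterBlockOf (K - n) (x.shift ν))))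
              (c (iterBlockOf (K - n) (x.shift ν)))))
      - (p (((x μ).val % (F.P K).L ^ (K - n))) * ∏ κ ∈ univ.erase μ, τ (((x κ).val % (F.P K).L ^ (K - n))))
          • conjR (Unitary.toUnits (suIncl ((axialT U₀ (Site.fibreSite 0 (K - n) (iterBlockOf (K - n) x) fun _ => (⟨0, pow_pos (F.P K).L_pos (K - n)⟩ : Fin ((F.P K).L ^ (K - n))))) x)))⁻¹
            (m • conjR (axialT (unitsField (toUField U₀)) (Site.fibreSite 0 (K - n) (iterBlockOf (K - n) x) fun _ => (⟨0, pow_pos (F.P K).L_pos (K - n)⟩ : Fin ((F.P K).L ^ (K - n)))) (embIter (K - n) (iterBlockOf (K - n) x)))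
              (c (iterBlockOf (K - n) x)))‖
      ≤ |m| * (2 * (Mp * Mτ ^ ((F.P K).d - 1)) * (2 * ((3 : ℝ) * ((F.L : ℝ) ^ (K - n) - 1)) * regThreshold F n K ε₀)
          + (Lp * Mτ ^ ((F.P K).d - 1) + Mp * Lτ * Mτ ^ ((F.P K).d - 2)) + Pl * Mτ ^ ((F.P K).d - 1)) * ‖c (iterBlockOf (K - n) x)‖ := by
  have hk : K - n ≤ (F.P K).m + (F.P K).K := by show K - n ≤ F.m + K; omega
  have hs0 : 0 ≤ 2 * ((3 : ℝ) * ((F.L : ℝ) ^ (K - n) - 1)) * regThreshold F n K ε₀ := by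
    have h1 : (1 : ℝ) ≤ (F.L : ℝ) ^ (K - n) := one_le_pow₀ (by have := F.hL.2; exact_mod_cast (by omega : 1 ≤ F.L))
    have := (regThreshold_pos F (n := n) (K := K) hε₀).le
    have : (0:ℝ) ≤ (F.L : ℝ) ^ (K - n) - 1 := by linarith
    positivity
  have hc0 : 0 ≤ ‖c (iterBlockOf (K - n) x)‖ := norm_nonneg _
  have hMψ := abs_psi_le (P := F.P K) (k := K - n) p τ hMp hMτ μ x
  have hU1ax : ∀ q y : Site (F.P K) 0, axialT (bgUnits F K U₀) q y ∈ U1 (Matrix (Fin 2) (Fin 2) ℂ) := fun q y => axialFrame_mem_U1 F K U₀ q y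
  -- rewrite the `SU(2)` transports in `(M₂)ˣ` letters and fold the dressings
  simp only [← axialT_bgUnits_eq, dressed_eq]
  rcases psi_bond hk p τ hp0 hτ0 hτl hMp hLp hpl hMτ hLτ hMp0 hLp0 hPl0 hMτ0 hLτ0 μ x ν with ⟨hblk, hlip⟩ | ⟨hzero, hψx⟩
  · -- interior bond: same block, Lipschitz profile, axial link near `1`
    rw [hblk]
    set q := Site.fibreSite 0 (K - n) (iterBlockOf (K - n) x) (fun _ => (⟨0, pow_pos (F.P K).L_pos (K - n)⟩ : Fin ((F.P K).L ^ (K - n)))) with hq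
    have hW : bgUnits F K U₀ ⟨x, ν⟩ ∈ U1 (Matrix (Fin 2) (Fin 2) ℂ) := unitsField_toUField_mem_U1' U₀ _
    have hlink : ‖((axialT (bgUnits F K U₀) q x * bgUnits F K U₀ ⟨x, ν⟩ * (axialT (bgUnits F K U₀) q (x.shift ν))⁻¹ : (Matrix (Fin 2) (Fin 2) ℂ)ˣ) : Matrix (Fin 2) (Fin 2) ℂ) - 1‖
        ≤ 2 * ((3 : ℝ) * ((F.L : ℝ) ^ (K - n) - 1)) * regThreshold F n K ε₀ := by
      have h := norm_axialGauge_bond_sub_one_le_T3 F hε₀ U₀ hU (iterBlockOf (K - n) x) ⟨x, ν⟩ rfl hblk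
      rwa [gaugeActT_apply] at h
    have hmain := norm_transport_dressed_sub_le (hU1ax q (embIter (K - n) (iterBlockOf (K - n) x))) (hU1ax q x) (hU1ax q (x.shift ν)) hW hlink
      ((p (((x μ).val % (F.P K).L ^ (K - n))) * ∏ κ ∈ univ.erase μ, τ (((x κ).val % (F.P K).L ^ (K - n)))) * m)
      ((p ((((x.shift ν) μ).val % (F.P K).L ^ (K - n))) * ∏ κ ∈ univ.erase μ, τ ((((x.shift ν) κ).val % (F.P K).L ^ (K - n)))) * m)
      (c (iterBlockOf (K - n) x))
    refine hmain.trans (mul_le_mul_of_nonneg_right ?_ hc0)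
    have hMψ' := abs_psi_le (P := F.P K) (k := K - n) p τ hMp hMτ μ (x.shift ν)
    have hm0 := abs_nonneg m
    have h1 : |(p ((((x.shift ν) μ).val % (F.P K).L ^ (K - n))) * ∏ κ ∈ univ.erase μ, τ ((((x.shift ν) κ).val % (F.P K).L ^ (K - n)))) * m|
        ≤ Mp * Mτ ^ ((F.P K).d - 1) * |m| := by
      rw [abs_mul]; exact mul_le_mul_of_nonneg_right hMψ' hm0
    have h2 : |(p ((((x.shift ν) μ).val % (F.P K).L ^ (K - n))) * ∏ κ ∈ univ.erase μ, τ ((((x.shift ν) κ).val % (F.P K).L ^ (K - n)))) * m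
          - (p (((x μ).val % (F.P K).L ^ (K - n))) * ∏ κ ∈ univ.erase μ, τ (((x κ).val % (F.P K).L ^ (K - n)))) * m|
        ≤ (Lp * Mτ ^ ((F.P K).d - 1) + Mp * Lτ * Mτ ^ ((F.P K).d - 2)) * |m| := by
      rw [← sub_mul, abs_mul]; exact mul_le_mul_of_nonneg_right hlip hm0
    calc 2 * |(p ((((x.shift ν) μ).val % (F.P K).L ^ (K - n))) * ∏ κ ∈ univ.erase μ, τ ((((x.shift ν) κ).val % (F.P K).L ^ (K - n)))) * m|
            * (2 * ((3 : ℝ) * ((F.L : ℝ) ^ (K - n) - 1)) * regThreshold F n K ε₀)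
          + |(p ((((x.shift ν) μ).val % (F.P K).L ^ (K - n))) * ∏ κ ∈ univ.erase μ, τ ((((x.shift ν) κ).val % (F.P K).L ^ (K - n)))) * m
              - (p (((x μ).val % (F.P K).L ^ (K - n))) * ∏ κ ∈ univ.erase μ, τ (((x κ).val % (F.P K).L ^ (K - n)))) * m|
        ≤ 2 * (Mp * Mτ ^ ((F.P K).d - 1) * |m|) * (2 * ((3 : ℝ) * ((F.L : ℝ) ^ (K - n) - 1)) * regThreshold F n K ε₀)
          + (Lp * Mτ ^ ((F.P K).d - 1) + Mp * Lτ * Mτ ^ ((F.P K).d - 2)) * |m| :=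
          add_le_add (mul_le_mul_of_nonneg_right (mul_le_mul_of_nonneg_left h1 (by norm_num)) hs0) h2
      _ = |m| * (2 * (Mp * Mτ ^ ((F.P K).d - 1)) * (2 * ((3 : ℝ) * ((F.L : ℝ) ^ (K - n) - 1)) * regThreshold F n K ε₀)
          + (Lp * Mτ ^ ((F.P K).d - 1) + Mp * Lτ * Mτ ^ ((F.P K).d - 2))) := by ring
      _ ≤ |m| * (2 * (Mp * Mτ ^ ((F.P K).d - 1)) * (2 * ((3 : ℝ) * ((F.L : ℝ) ^ (K - n) - 1)) * regThreshold F n K ε₀)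
          + (Lp * Mτ ^ ((F.P K).d - 1) + Mp * Lτ * Mτ ^ ((F.P K).d - 2)) + Pl * Mτ ^ ((F.P K).d - 1)) :=
          mul_le_mul_of_nonneg_left (le_add_of_nonneg_right (by positivity)) hm0
  · -- a bond across a block face: the shifted end vanishes
    rw [hzero, zero_mul, Complex.ofReal_zero, zero_smul]
    have h0 : conjR (bgUnits F K U₀ ⟨x, ν⟩) (0 : Matrix (Fin 2) (Fin 2) ℂ) = 0 := by rw [conjR_apply, mul_zero, zero_mul]
    rw [h0, zero_sub, norm_neg, norm_smul, Complex.norm_real, Real.norm_eq_abs, abs_mul,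
      norm_conjR ((U1 _).inv_mem ((U1 _).mul_mem ((U1 _).inv_mem (axialFrame_mem_U1 F K U₀ _ _)) (hU1ax _ _)))]
    calc |p (((x μ).val % (F.P K).L ^ (K - n))) * ∏ κ ∈ univ.erase μ, τ (((x κ).val % (F.P K).L ^ (K - n)))| * |m| * ‖c (iterBlockOf (K - n) x)‖
        ≤ (Pl * Mτ ^ ((F.P K).d - 1)) * |m| * ‖c (iterBlockOf (K - n) x)‖ := by gcongr
      _ ≤ |m| * (2 * (Mp * Mτ ^ ((F.P K).d - 1)) * (2 * ((3 : ℝ) * ((F.L : ℝ) ^ (K - n) - 1)) * regThreshold F n K ε₀)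
          + (Lp * Mτ ^ ((F.P K).d - 1) + Mp * Lτ * Mτ ^ ((F.P K).d - 2)) + Pl * Mτ ^ ((F.P K).d - 1)) * ‖c (iterBlockOf (K - n) x)‖ := by
          have hm0 := abs_nonneg m
          have hMM : 0 ≤ Mp * Mτ ^ ((F.P K).d - 1) := by positivity
          nlinarith [mul_nonneg (mul_nonneg hm0 hMM) hc0, mul_nonneg (mul_nonneg hm0 hs0) (mul_nonneg hMM hc0),
            mul_nonneg hm0 (mul_nonneg (by positivity : 0 ≤ Lp * Mτ ^ ((F.P K).d - 1) + Mp * Lτ * Mτ ^ ((F.P K).d - 2)) hc0)]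

end Bond

/-! ## §3 The (s2) row of the transported interpolant -/

section Rows

variable (F : T3Family) (n K : ℕ) (h : n ≤ K) (c₀ cB : ℝ) [Fact (0 < c₀)] [Fact (0 < cB)]

/-- ★★ **THE COVARIANT GRADIENT ROW OF THE TRANSPORTED INTERPOLANT FIELD** (`PlaqSmall (regThreshold F n K ε₀) U₀`, `n < K`, generic separable profile with the §1 letters, amplitude `m`):
`Σ_μ ‖D^η_{U₀}(toL2S (A_C)^μ)‖² ≤ 2c₀η⁻²·B_c²·d·ℓ^d·cB⁻¹·‖toL2B C‖²`, `B_c = |m|(2M_ψs + Lip_ψ + M_ψ)` — §2 summed by ✓`normSq_DL2_le_of_blockDominated` against the coarse data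
`z ↦ C(e⁻¹⟨z, μ⟩)`, then `Σ_μΣ_z‖C(e⁻¹⟨z,μ⟩)‖²_op ≤ cB⁻¹‖toL2B C‖²` (operator ≤ Frobenius). [cite: Balaban1985BackgroundPropagators, (3.3) p.391, (3.11) p.392; Balaban1985RegularSpaces, Lemma 1 (1.25) p.79] -/
theorem sum_normSq_DL2_interpolant_le (hnK : n < K) {ε₀ : ℝ} (hε₀ : 0 < ε₀) (U₀ : GaugeField (F.P K) 0 (Matrix.specialUnitaryGroup (Fin 2) ℂ))
    (hU : PlaqSmall (regThreshold F n K ε₀) U₀) (p τ : ℕ → ℝ) (hp0 : p 0 = 0) (hτ0 : τ 0 = 0) (hτl : τ ((F.P K).L ^ (K - n) - 1) = 0) {Mp Lp Pl Mτ Lτ : ℝ}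
    (hMp : ∀ s, s < (F.P K).L ^ (K - n) → |p s| ≤ Mp) (hLp : ∀ s, s + 1 < (F.P K).L ^ (K - n) → |p (s + 1) - p s| ≤ Lp) (hpl : |p ((F.P K).L ^ (K - n) - 1)| ≤ Pl)
    (hMτ : ∀ m, m < (F.P K).L ^ (K - n) → |τ m| ≤ Mτ) (hLτ : ∀ m, m + 1 < (F.P K).L ^ (K - n) → |τ (m + 1) - τ m| ≤ Lτ)
    (hMp0 : 0 ≤ Mp) (hLp0 : 0 ≤ Lp) (hPl0 : 0 ≤ Pl) (hMτ0 : 0 ≤ Mτ) (hLτ0 : 0 ≤ Lτ) (m : ℝ)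
    (C : PBond (F.P n) 0 → Matrix (Fin 2) (Fin 2) ℂ) :
    ∑ μ : Fin (F.P K).d, ‖DL2 F n K c₀ U₀ (toL2S F K c₀ (formComp
      (fun b : PBond (F.P K) 0 =>
        (p ((b.src b.dir).val % (F.P K).L ^ (K - n)) * ∏ ν ∈ univ.erase b.dir, τ ((b.src ν).val % (F.P K).L ^ (K - n)))
          • conjR (Unitary.toUnits (suIncl ((axialT U₀ (Site.fibreSite 0 (K - n) (iterBlockOf (K - n) b.src) fun _ => (⟨0, pow_pos (F.P K).L_pos (K - n)⟩ : Fin ((F.P K).L ^ (K - n))))) b.src)))⁻¹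
            (m • conjR (axialT (unitsField (toUField U₀)) (Site.fibreSite 0 (K - n) (iterBlockOf (K - n) b.src) fun _ => (⟨0, pow_pos (F.P K).L_pos (K - n)⟩ : Fin ((F.P K).L ^ (K - n)))) (embIter (K - n) (iterBlockOf (K - n) b.src)))
              (C ((bondShift (sites_eq F n K h)).symm ⟨iterBlockOf (K - n) b.src, b.dir⟩)))) μ))‖ ^ 2
      ≤ (2 * c₀ * ((eta F n K)⁻¹ ^ 2 * ((|m| * (2 * (Mp * Mτ ^ ((F.P K).d - 1)) * (2 * ((3 : ℝ) * ((F.L : ℝ) ^ (K - n) - 1)) * regThreshold F n K ε₀)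
          + (Lp * Mτ ^ ((F.P K).d - 1) + Mp * Lτ * Mτ ^ ((F.P K).d - 2)) + Pl * Mτ ^ ((F.P K).d - 1))) ^ 2 * (F.P K).d * ((((F.P K).L ^ (F.P K).d) ^ (K - n) : ℕ) : ℝ))) * cB⁻¹)
        * ‖toL2B F n cB C‖ ^ 2 := by
  classical
  have hk : K - n ≤ (F.P K).m + (F.P K).K := by show K - n ≤ F.m + K; omega
  have hc₀ : (0 : ℝ) < c₀ := Fact.out
  have hcB : (0 : ℝ) < cB := Fact.out
  -- per component: the block-dominated `H¹` row
  have hμ : ∀ μ : Fin (F.P K).d, ‖DL2 F n K c₀ U₀ (toL2S F K c₀ (formComp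
      (fun b : PBond (F.P K) 0 =>
        (p ((b.src b.dir).val % (F.P K).L ^ (K - n)) * ∏ ν ∈ univ.erase b.dir, τ ((b.src ν).val % (F.P K).L ^ (K - n)))
          • conjR (Unitary.toUnits (suIncl ((axialT U₀ (Site.fibreSite 0 (K - n) (iterBlockOf (K - n) b.src) fun _ => (⟨0, pow_pos (F.P K).L_pos (K - n)⟩ : Fin ((F.P K).L ^ (K - n))))) b.src)))⁻¹
            (m • conjR (axialT (unitsField (toUField U₀)) (Site.fibreSite 0 (K - n) (iterBlockOf (K - n) b.src) fun _ => (⟨0, pow_pos (F.P K).L_pos (K - n)⟩ : Fin ((F.P K).L ^ (K - n)))) (embIter (K - n) (iterBlockOf (K - n) b.src)))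
              (C ((bondShift (sites_eq F n K h)).symm ⟨iterBlockOf (K - n) b.src, b.dir⟩)))) μ))‖ ^ 2
      ≤ 2 * c₀ * ((eta F n K)⁻¹ ^ 2 * ((|m| * (2 * (Mp * Mτ ^ ((F.P K).d - 1)) * (2 * ((3 : ℝ) * ((F.L : ℝ) ^ (K - n) - 1)) * regThreshold F n K ε₀)
          + (Lp * Mτ ^ ((F.P K).d - 1) + Mp * Lτ * Mτ ^ ((F.P K).d - 2)) + Pl * Mτ ^ ((F.P K).d - 1))) ^ 2 * (F.P K).d * ((((F.P K).L ^ (F.P K).d) ^ (K - n) : ℕ) : ℝ)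
          * ∑ z : Site (F.P K) (K - n), ‖C ((bondShift (sites_eq F n K h)).symm ⟨z, μ⟩)‖ ^ 2)) := fun μ =>
    normSq_DL2_le_of_blockDominated F hk U₀ _ (fun z : Site (F.P K) (K - n) => C ((bondShift (sites_eq F n K h)).symm ⟨z, μ⟩))
      (fun x ν => norm_transport_bump_bond_le F n K hnK hε₀ U₀ hU p τ hp0 hτ0 hτl hMp hLp hpl hMτ hLτ hMp0 hLp0 hPl0 hMτ0 hLτ0 m
        (fun z : Site (F.P K) (K - n) => C ((bondShift (sites_eq F n K h)).symm ⟨z, μ⟩)) μ x ν)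
  -- the coarse data: operator norm ≤ Frobenius, summed over all coarse bonds
  have hdata : ∑ μ : Fin (F.P K).d, ∑ z : Site (F.P K) (K - n), ‖C ((bondShift (sites_eq F n K h)).symm ⟨z, μ⟩)‖ ^ 2 ≤ cB⁻¹ * ‖toL2B F n cB C‖ ^ 2 := by
    rw [norm_sq_toL2B, ← mul_assoc, inv_mul_cancel₀ hcB.ne', one_mul]
    calc ∑ μ : Fin (F.P K).d, ∑ z : Site (F.P K) (K - n), ‖C ((bondShift (sites_eq F n K h)).symm ⟨z, μ⟩)‖ ^ 2
        = ∑ ŷ : PBond (F.P K) (K - n), ‖C ((bondShift (sites_eq F n K h)).symm ŷ)‖ ^ 2 := by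
          rw [Finset.sum_comm]; exact (B10StarCount.sum_pbond (fun ŷ : PBond (F.P K) (K - n) => ‖C ((bondShift (sites_eq F n K h)).symm ŷ)‖ ^ 2)).symm
      _ = ∑ c' : PBond (F.P n) 0, ‖C c'‖ ^ 2 := Fintype.sum_equiv (bondShift (sites_eq F n K h)).symm _ _ (fun _ => rfl)
      _ ≤ ∑ c' : PBond (F.P n) 0, ∑ i, ∑ i', ‖C c' i i'‖ ^ 2 := Finset.sum_le_sum fun c' _ => by
          rw [← norm_sq_frobEquiv_symm]
          exact pow_le_pow_left₀ (norm_nonneg _) (norm_le_norm_frobEquiv_symm (C c')) 2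
  calc ∑ μ : Fin (F.P K).d, ‖DL2 F n K c₀ U₀ (toL2S F K c₀ (formComp
      (fun b : PBond (F.P K) 0 =>
        (p ((b.src b.dir).val % (F.P K).L ^ (K - n)) * ∏ ν ∈ univ.erase b.dir, τ ((b.src ν).val % (F.P K).L ^ (K - n)))
          • conjR (Unitary.toUnits (suIncl ((axialT U₀ (Site.fibreSite 0 (K - n) (iterBlockOf (K - n) b.src) fun _ => (⟨0, pow_pos (F.P K).L_pos (K - n)⟩ : Fin ((F.P K).L ^ (K - n))))) b.src)))⁻¹
            (m • conjR (axialT (unitsField (toUField U₀)) (Site.fibreSite 0 (K - n) (iterBlockOf (K - n) b.src) fun _ => (⟨0, pow_pos (F.P K).L_pos (K - n)⟩ : Fin ((F.P K).L ^ (K - n)))) (embIter (K - n) (iterBlockOf (K - n) b.src)))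
              (C ((bondShift (sites_eq F n K h)).symm ⟨iterBlockOf (K - n) b.src, b.dir⟩)))) μ))‖ ^ 2
      ≤ ∑ μ : Fin (F.P K).d, 2 * c₀ * ((eta F n K)⁻¹ ^ 2 * ((|m| * (2 * (Mp * Mτ ^ ((F.P K).d - 1)) * (2 * ((3 : ℝ) * ((F.L : ℝ) ^ (K - n) - 1)) * regThreshold F n K ε₀)
          + (Lp * Mτ ^ ((F.P K).d - 1) + Mp * Lτ * Mτ ^ ((F.P K).d - 2)) + Pl * Mτ ^ ((F.P K).d - 1))) ^ 2 * (F.P K).d * ((((F.P K).L ^ (F.P K).d) ^ (K - n) : ℕ) : ℝ)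
          * ∑ z : Site (F.P K) (K - n), ‖C ((bondShift (sites_eq F n K h)).symm ⟨z, μ⟩)‖ ^ 2)) := Finset.sum_le_sum fun μ _ => hμ μ
    _ = 2 * c₀ * ((eta F n K)⁻¹ ^ 2 * ((|m| * (2 * (Mp * Mτ ^ ((F.P K).d - 1)) * (2 * ((3 : ℝ) * ((F.L : ℝ) ^ (K - n) - 1)) * regThreshold F n K ε₀)
          + (Lp * Mτ ^ ((F.P K).d - 1) + Mp * Lτ * Mτ ^ ((F.P K).d - 2)) + Pl * Mτ ^ ((F.P K).d - 1))) ^ 2 * (F.P K).d * ((((F.P K).L ^ (F.P K).d) ^ (K - n) : ℕ) : ℝ)))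
          * ∑ μ : Fin (F.P K).d, ∑ z : Site (F.P K) (K - n), ‖C ((bondShift (sites_eq F n K h)).symm ⟨z, μ⟩)‖ ^ 2 := by
          rw [Finset.mul_sum]; refine Finset.sum_congr rfl fun μ _ => ?_; ring
    _ ≤ 2 * c₀ * ((eta F n K)⁻¹ ^ 2 * ((|m| * (2 * (Mp * Mτ ^ ((F.P K).d - 1)) * (2 * ((3 : ℝ) * ((F.L : ℝ) ^ (K - n) - 1)) * regThreshold F n K ε₀)
          + (Lp * Mτ ^ ((F.P K).d - 1) + Mp * Lτ * Mτ ^ ((F.P K).d - 2)) + Pl * Mτ ^ ((F.P K).d - 1))) ^ 2 * (F.P K).d * ((((F.P K).L ^ (F.P K).d) ^ (K - n) : ℕ) : ℝ)))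
          * (cB⁻¹ * ‖toL2B F n cB C‖ ^ 2) := mul_le_mul_of_nonneg_left hdata (by positivity)
    _ = (2 * c₀ * ((eta F n K)⁻¹ ^ 2 * ((|m| * (2 * (Mp * Mτ ^ ((F.P K).d - 1)) * (2 * ((3 : ℝ) * ((F.L : ℝ) ^ (K - n) - 1)) * regThreshold F n K ε₀)
          + (Lp * Mτ ^ ((F.P K).d - 1) + Mp * Lτ * Mτ ^ ((F.P K).d - 2)) + Pl * Mτ ^ ((F.P K).d - 1))) ^ 2 * (F.P K).d * ((((F.P K).L ^ (F.P K).d) ^ (K - n) : ℕ) : ℝ))) * cB⁻¹)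
        * ‖toL2B F n cB C‖ ^ 2 := by ring

/-- ★★★ **THE (s2) LETTER `hED` FOR ANY INTERPOLANT WITH THIS FIELD** (px12 ✓`Prop7KinvBoundOfInterpolant.norm_KinvT_le_of_interpolant_rows`): if `toL2⁻¹(E c) = A_{toL2B⁻¹c}` (the formula
conjunct of ✓`Prop7TransportedInterpolant.exists_transportedInterpolant`), then `∀ c, Σ_μ ‖D^η_{U₀}(toL2S (toL2⁻¹(E c))^μ)‖² ≤ C_D·‖c‖²`, `C_D = 2c₀η⁻²B_c²dℓ^d∕cB`.
[cite: Balaban1985BackgroundPropagators, (3.3) p.391, (3.11) p.392, (3.126)–(3.132) pp.420–422] -/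
theorem hED_of_formula (hnK : n < K) {ε₀ : ℝ} (hε₀ : 0 < ε₀) (U₀ : GaugeField (F.P K) 0 (Matrix.specialUnitaryGroup (Fin 2) ℂ))
    (hU : PlaqSmall (regThreshold F n K ε₀) U₀) (p τ : ℕ → ℝ) (hp0 : p 0 = 0) (hτ0 : τ 0 = 0) (hτl : τ ((F.P K).L ^ (K - n) - 1) = 0) {Mp Lp Pl Mτ Lτ : ℝ}
    (hMp : ∀ s, s < (F.P K).L ^ (K - n) → |p s| ≤ Mp) (hLp : ∀ s, s + 1 < (F.P K).L ^ (K - n) → |p (s + 1) - p s| ≤ Lp) (hpl : |p ((F.P K).L ^ (K - n) - 1)| ≤ Pl)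
    (hMτ : ∀ m, m < (F.P K).L ^ (K - n) → |τ m| ≤ Mτ) (hLτ : ∀ m, m + 1 < (F.P K).L ^ (K - n) → |τ (m + 1) - τ m| ≤ Lτ)
    (hMp0 : 0 ≤ Mp) (hLp0 : 0 ≤ Lp) (hPl0 : 0 ≤ Pl) (hMτ0 : 0 ≤ Mτ) (hLτ0 : 0 ≤ Lτ) (m : ℝ)
    (E : WL2 ℂ (fun _ : PBond (F.P n) 0 => cB) W₂ →ₗ[ℂ] BondL2K ℂ 3 (periodsT3 F K) c₀ W₂)
    (hf : ∀ (c : WL2 ℂ (fun _ : PBond (F.P n) 0 => cB) W₂) (b : PBond (F.P K) 0), (toL2 F K c₀).symm (E c) b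
      = (fun b : PBond (F.P K) 0 =>
        (p ((b.src b.dir).val % (F.P K).L ^ (K - n)) * ∏ ν ∈ univ.erase b.dir, τ ((b.src ν).val % (F.P K).L ^ (K - n)))
          • conjR (Unitary.toUnits (suIncl ((axialT U₀ (Site.fibreSite 0 (K - n) (iterBlockOf (K - n) b.src) fun _ => (⟨0, pow_pos (F.P K).L_pos (K - n)⟩ : Fin ((F.P K).L ^ (K - n))))) b.src)))⁻¹
            (m • conjR (axialT (unitsField (toUField U₀)) (Site.fibreSite 0 (K - n) (iterBlockOf (K - n) b.src) fun _ => (⟨0, pow_pos (F.P K).L_pos (K - n)⟩ : Fin ((F.P K).L ^ (K - n)))) (embIter (K - n) (iterBlockOf (K - n) b.src)))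
              ((toL2B F n cB).symm c ((bondShift (sites_eq F n K h)).symm ⟨iterBlockOf (K - n) b.src, b.dir⟩)))) b) :
    ∀ c : WL2 ℂ (fun _ : PBond (F.P n) 0 => cB) W₂,
      ∑ μ : Fin (F.P K).d, ‖DL2 F n K c₀ U₀ (toL2S F K c₀ (formComp ((toL2 F K c₀).symm (E c)) μ))‖ ^ 2
        ≤ (2 * c₀ * ((eta F n K)⁻¹ ^ 2 * ((|m| * (2 * (Mp * Mτ ^ ((F.P K).d - 1)) * (2 * ((3 : ℝ) * ((F.L : ℝ) ^ (K - n) - 1)) * regThreshold F n K ε₀)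
          + (Lp * Mτ ^ ((F.P K).d - 1) + Mp * Lτ * Mτ ^ ((F.P K).d - 2)) + Pl * Mτ ^ ((F.P K).d - 1))) ^ 2 * (F.P K).d * ((((F.P K).L ^ (F.P K).d) ^ (K - n) : ℕ) : ℝ))) * cB⁻¹) * ‖c‖ ^ 2 := by
  intro c
  have hfun : (toL2 F K c₀).symm (E c) = (fun b : PBond (F.P K) 0 =>
        (p ((b.src b.dir).val % (F.P K).L ^ (K - n)) * ∏ ν ∈ univ.erase b.dir, τ ((b.src ν).val % (F.P K).L ^ (K - n)))
          • conjR (Unitary.toUnits (suIncl ((axialT U₀ (Site.fibreSite 0 (K - n) (iterBlockOf (K - n) b.src) fun _ => (⟨0, pow_pos (F.P K).L_pos (K - n)⟩ : Fin ((F.P K).L ^ (K - n))))) b.src)))⁻¹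
            (m • conjR (axialT (unitsField (toUField U₀)) (Site.fibreSite 0 (K - n) (iterBlockOf (K - n) b.src) fun _ => (⟨0, pow_pos (F.P K).L_pos (K - n)⟩ : Fin ((F.P K).L ^ (K - n)))) (embIter (K - n) (iterBlockOf (K - n) b.src)))
              ((toL2B F n cB).symm c ((bondShift (sites_eq F n K h)).symm ⟨iterBlockOf (K - n) b.src, b.dir⟩)))) := funext (hf c)
  have hmain := sum_normSq_DL2_interpolant_le F n K h c₀ cB hnK hε₀ U₀ hU p τ hp0 hτ0 hτl hMp hLp hpl hMτ hLτ hMp0 hLp0 hPl0 hMτ0 hLτ0 m ((toL2B F n cB).symm c)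
  rw [LinearEquiv.apply_symm_apply] at hmain
  rw [hfun]
  exact hmain

end Rows

end Summit.QuantumFields.YangMills.Theorems.Prop7TransportedInterpolantGradient

end
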